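/-
Copyright (c) 2026 the pub-hodgecm-mathlib formalisation cell (harness21).  Prover seat hodgecm-mathlib-K2Liu-p11 (g2), Track B «K2-LIT»,
#184♮ = hLiu418 = `stmt-HodgeConjecture-24832`; A7-val road (σ) «null-cone multiplicity one» (K2Liu-p09 (g6) memo 0ec4b1215f8a4fcc §3),
K2E5-plan (g7) fan-out 11:19:22Z «V2 `K2LiuNullConeSupport` → K2Liu-p11 (g2)», file V2a = the GENERIC ALGEBRAIC CORE of (N).  THEOREMS ONLY
(no `def`, no `instance`, no notation, no named-fact hypothesis, no `sorry`).
-/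
import Mathlib.NumberTheory.LegendreSymbol.AddCharacter
import Mathlib.GroupTheory.Index
import HarnessLib

/-!
# Crux `HLiu418`, A7-val (σ), V2a: an invariant functional kills a vector on which a finite quotient of characters averages to zero

Cell `hodgecm-mathlib`, crux item hLiu418 = `stmt-HodgeConjecture-24832` (helper lane `--supports`, count-neutral).

The finitary heart of [BernsteinZelevinsky1976, §1.1–1.5] «a distribution invariant under the characters `ψ(tr(b·Q(x)))`, `b ∈ Herm₂`,
is supported on the null cone `Q = 0`», with NO Haar measure and NO continuity of the functional.  GENERIC data:
* `X` any type, `V` a `ℂ`-module realised INJECTIVELY as functions `coe : V →ₗ[ℂ] (X → ℂ)` (e.g. `𝒮(X) ≤ (X → ℂ)`);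
* `B` an additive group and a system `e : B → X → ℂ` (think `e b x = ψ(tr(b·Q x))`), with MULTIPLICATION OPERATORS `M b : V →ₗ[ℂ] V`,
  `coe (M b Φ) x = e b x · coe Φ x` (think `ω(n(b))`);
* subgroups `L′ ≤ L ≤ B` with `L′` of FINITE INDEX in `L`, `e` multiplicative on `L` with `e 0 = 1`;
* a `ℂ`-linear `T : V →ₗ[ℂ] ℂ` with `T (M b Φ) = T Φ` for `b ∈ L`.
THEN (`apply_eq_zero_of_invariant`): every `Φ` such that on its support `e b′ · = 1` for `b′ ∈ L′` («`L′` small») and at each point of the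
support SOME `b ∈ L` has `e b x ≠ 1` («`L` large», i.e. `Q(x) ≠ 0`) satisfies **`T Φ = 0`**: the characters `b ↦ e b x` descend to
NON-trivial characters of the finite group `L ∕ L′` and sum to zero (Mathlib `AddChar.sum_eq_zero_of_ne_one`), so
`[L : L′] · T Φ = Σ_{q} T (M (rep q) Φ) = T (Σ_q M (rep q) Φ) = T 0 = 0`.
File V2b `K2LiuNullConeSupport` supplies `L′ ≤ L` from the topology of `Herm₂(E_v)` (compact-open subgroups) in the Schrödinger model.
References: [BernsteinZelevinsky1976, §1.1–1.5]; [KudlaRallis1990, §2].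
HONEST LABEL: HC_CM is proved only modulo the 7 printed citations (2 remaining named inputs: hLiu418 = stmt-HodgeConjecture-24832,
h413 = stmt-HodgeConjecture-24833) until rung 0 closes; count-neutral helper, closes no socket.
-/

set_option autoImplicit false
set_option linter.dupNamespace false

noncomputable section

open Finset

namespace Summit.HodgeConjecture.HodgeConjecture.Cruxes.HLiu418.K2LiuInvariantFunctionalFiniteAveraging

variable {X B V : Type*} [AddCommGroup B] [AddCommGroup V] [Module ℂ V]

/-! ## §1  Characters of `L` trivial on `L′` -/

/-- A multiplicative system `e · x` on `L` which is `1` on `L′` is constant on `L′`-cosets: `e (b + n) x = e b x` (`b ∈ L`, `n ∈ L′`). [folklore] -/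
theorem apply_add_eq_of_mem {e : B → X → ℂ} {L L' : AddSubgroup B} (hle : L' ≤ L)
    (he : ∀ b ∈ L, ∀ b' ∈ L, ∀ x : X, e (b + b') x = e b x * e b' x) {x : X} (htriv : ∀ b' ∈ L', e b' x = 1)
    {b n : B} (hb : b ∈ L) (hn : n ∈ L') : e (b + n) x = e b x := by
  rw [he b hb n (hle hn) x, htriv n hn, mul_one]

/-- Two representatives of the same class of `L ⧸ L′` give the same character value. [folklore] -/
theorem apply_eq_of_quotient_eq {e : B → X → ℂ} {L L' : AddSubgroup B} (hle : L' ≤ L)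
    (he : ∀ b ∈ L, ∀ b' ∈ L, ∀ x : X, e (b + b') x = e b x * e b' x) {x : X} (htriv : ∀ b' ∈ L', e b' x = 1)
    {a c : L} (h : (QuotientAddGroup.mk a : L ⧸ L'.addSubgroupOf L) = QuotientAddGroup.mk c) :
    e (a : B) x = e (c : B) x := by
  rw [QuotientAddGroup.eq] at h
  -- `-a + c ∈ L′`, so `c = a + (-a + c)`
  have hmem : ((-a + c : L) : B) ∈ L' := by
    simpa [AddSubgroup.mem_addSubgroupOf] using h
  have hc : ((c : L) : B) = (a : B) + ((-a + c : L) : B) := by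
    push_cast
    abel
  rw [hc]
  exact (apply_add_eq_of_mem hle he htriv a.2 hmem).symm

/-- **THE CHARACTER SUM OVER `L ⧸ L′` VANISHES** when `b ↦ e b x` (multiplicative on `L`, `e 0 x = 1`, trivial on `L′`) is NOT identically
`1` on `L`: `Σ_{q ∈ L∕L′} e (rep q) x = 0` for the representatives `rep q = q.out`. [BernsteinZelevinsky1976, §1.3] -/
theorem sum_apply_out_eq_zero {e : B → X → ℂ} {L L' : AddSubgroup B} (hle : L' ≤ L) [Fintype (L ⧸ L'.addSubgroupOf L)]
    (he : ∀ b ∈ L, ∀ b' ∈ L, ∀ x : X, e (b + b') x = e b x * e b' x) (he0 : ∀ x : X, e 0 x = 1) {x : X}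
    (htriv : ∀ b' ∈ L', e b' x = 1) (hnon : ∃ b ∈ L, e b x ≠ 1) :
    ∑ q : L ⧸ L'.addSubgroupOf L, e ((Quotient.out q : L) : B) x = 0 := by
  -- the character of `L ⧸ L′`
  let ψ : AddChar (L ⧸ L'.addSubgroupOf L) ℂ :=
    { toFun := fun q => e ((Quotient.out q : L) : B) x
      map_zero_eq_one' := by
        have h0 : (QuotientAddGroup.mk (Quotient.out (0 : L ⧸ L'.addSubgroupOf L)) : L ⧸ L'.addSubgroupOf L) =
            QuotientAddGroup.mk (0 : L) := by
          rw [QuotientAddGroup.out_eq', QuotientAddGroup.mk_zero]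
        rw [apply_eq_of_quotient_eq hle he htriv h0, AddSubgroup.coe_zero, he0]
      map_add_eq_mul' := by
        intro q q'
        have h : (QuotientAddGroup.mk (Quotient.out (q + q')) : L ⧸ L'.addSubgroupOf L) =
            QuotientAddGroup.mk (Quotient.out q + Quotient.out q') := by
          rw [QuotientAddGroup.out_eq', QuotientAddGroup.mk_add, QuotientAddGroup.out_eq', QuotientAddGroup.out_eq']
        rw [apply_eq_of_quotient_eq hle he htriv h, AddSubgroup.coe_add, he _ (Quotient.out q).2 _ (Quotient.out q').2] }
  have hψ : ψ ≠ 1 := by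
    obtain ⟨b, hb, hbx⟩ := hnon
    intro h1
    have hval : ψ (QuotientAddGroup.mk (⟨b, hb⟩ : L)) = 1 := by rw [h1, AddChar.one_apply]
    have hrep : ψ (QuotientAddGroup.mk (⟨b, hb⟩ : L)) = e b x := by
      show e ((Quotient.out (QuotientAddGroup.mk (⟨b, hb⟩ : L) : L ⧸ L'.addSubgroupOf L) : L) : B) x = e b x
      have h : (QuotientAddGroup.mk (Quotient.out (QuotientAddGroup.mk (⟨b, hb⟩ : L) : L ⧸ L'.addSubgroupOf L)) :
          L ⧸ L'.addSubgroupOf L) = QuotientAddGroup.mk (⟨b, hb⟩ : L) := QuotientAddGroup.out_eq' _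
      rw [apply_eq_of_quotient_eq hle he htriv h]
    exact hbx (hrep ▸ hval)
  exact AddChar.sum_eq_zero_of_ne_one hψ

/-! ## §2  The invariant functional kills `Φ` -/

/-- **AN `L`-INVARIANT FUNCTIONAL KILLS EVERY VECTOR ON WHOSE SUPPORT THE CHARACTERS OF `L ⧸ L′` ARE NON-TRIVIAL.**
Data: `coe : V →ₗ[ℂ] (X → ℂ)` injective; `M b : V →ₗ[ℂ] V` acting as multiplication by `e b ·`; `T : V →ₗ[ℂ] ℂ` with `T ∘ M b = T` for
`b ∈ L`; `L′ ≤ L` of finite index; `e` multiplicative on `L`, `e 0 = 1`.  If on the support of `coe Φ` every `e b′ ·` (`b′ ∈ L′`) is `1` and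
at every point of the support some `b ∈ L` has `e b x ≠ 1`, then `T Φ = 0`. [BernsteinZelevinsky1976, §1.1–1.5; KudlaRallis1990, §2] -/
theorem apply_eq_zero_of_invariant (coe : V →ₗ[ℂ] (X → ℂ)) (hcoe : Function.Injective coe)
    (e : B → X → ℂ) (M : B → V →ₗ[ℂ] V) (hM : ∀ b (Φ : V) (x : X), coe (M b Φ) x = e b x * coe Φ x)
    {L L' : AddSubgroup B} (hle : L' ≤ L) [(L'.addSubgroupOf L).FiniteIndex]
    (he : ∀ b ∈ L, ∀ b' ∈ L, ∀ x : X, e (b + b') x = e b x * e b' x) (he0 : ∀ x : X, e 0 x = 1)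
    (T : V →ₗ[ℂ] ℂ) (hT : ∀ b ∈ L, ∀ Φ : V, T (M b Φ) = T Φ)
    (Φ : V) (htriv : ∀ x : X, coe Φ x ≠ 0 → ∀ b' ∈ L', e b' x = 1)
    (hnon : ∀ x : X, coe Φ x ≠ 0 → ∃ b ∈ L, e b x ≠ 1) :
    T Φ = 0 := by
  haveI := AddSubgroup.fintypeQuotientOfFiniteIndex (H := L'.addSubgroupOf L)
  -- the averaged vector vanishes
  have hsum : ∑ q : L ⧸ L'.addSubgroupOf L, M ((Quotient.out q : L) : B) Φ = 0 := by
    apply hcoe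
    rw [map_sum, map_zero]
    funext x
    rw [Finset.sum_apply, Pi.zero_apply]
    simp only [hM]
    rw [← Finset.sum_mul]
    by_cases hx : coe Φ x = 0
    · rw [hx, mul_zero]
    · rw [sum_apply_out_eq_zero hle he he0 (htriv x hx) (hnon x hx), zero_mul]
  -- sum the invariance over the classes
  have hcard : ∑ q : L ⧸ L'.addSubgroupOf L, T (M ((Quotient.out q : L) : B) Φ) =
      (Fintype.card (L ⧸ L'.addSubgroupOf L) : ℂ) * T Φ := by
    rw [Finset.sum_congr rfl fun q _ => hT _ (Quotient.out q).2 Φ, Finset.sum_const, Finset.card_univ, nsmul_eq_mul]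
  have h : (Fintype.card (L ⧸ L'.addSubgroupOf L) : ℂ) * T Φ = 0 := by
    rw [← hcard, ← map_sum, hsum, map_zero]
  have hne : (Fintype.card (L ⧸ L'.addSubgroupOf L) : ℂ) ≠ 0 :=
    Nat.cast_ne_zero.mpr (Fintype.card_ne_zero)
  exact (mul_eq_zero.mp h).resolve_left hne

/-- **THE SAME ON A SUBMODULE OF FUNCTIONS** (`V ≤ (X → ℂ)`, e.g. `V = 𝒮(X)`): multiplication operators given as endomorphisms of `V`.
[BernsteinZelevinsky1976, §1.1–1.5] -/
theorem apply_eq_zero_of_invariant_submodule {W : Submodule ℂ (X → ℂ)}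
    (e : B → X → ℂ) (M : B → W →ₗ[ℂ] W) (hM : ∀ b (Φ : W) (x : X), (M b Φ : X → ℂ) x = e b x * (Φ : X → ℂ) x)
    {L L' : AddSubgroup B} (hle : L' ≤ L) [(L'.addSubgroupOf L).FiniteIndex]
    (he : ∀ b ∈ L, ∀ b' ∈ L, ∀ x : X, e (b + b') x = e b x * e b' x) (he0 : ∀ x : X, e 0 x = 1)
    (T : W →ₗ[ℂ] ℂ) (hT : ∀ b ∈ L, ∀ Φ : W, T (M b Φ) = T Φ)
    (Φ : W) (htriv : ∀ x : X, (Φ : X → ℂ) x ≠ 0 → ∀ b' ∈ L', e b' x = 1)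
    (hnon : ∀ x : X, (Φ : X → ℂ) x ≠ 0 → ∃ b ∈ L, e b x ≠ 1) :
    T Φ = 0 :=
  apply_eq_zero_of_invariant W.subtype W.injective_subtype e M hM hle he he0 T hT Φ htriv hnon

/-- **POINTWISE-MULTIPLICATION FORM** for functionals on ALL functions `X → ℂ` (the case `V = X → ℂ`, `M b Φ = e b · Φ`).
[BernsteinZelevinsky1976, §1.1–1.5] -/
theorem apply_eq_zero_of_invariant_pi (e : B → X → ℂ) {L L' : AddSubgroup B} (hle : L' ≤ L) [(L'.addSubgroupOf L).FiniteIndex]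
    (he : ∀ b ∈ L, ∀ b' ∈ L, ∀ x : X, e (b + b') x = e b x * e b' x) (he0 : ∀ x : X, e 0 x = 1)
    (T : (X → ℂ) →ₗ[ℂ] ℂ) (hT : ∀ b ∈ L, ∀ Φ : X → ℂ, T (fun x => e b x * Φ x) = T Φ)
    (Φ : X → ℂ) (htriv : ∀ x : X, Φ x ≠ 0 → ∀ b' ∈ L', e b' x = 1) (hnon : ∀ x : X, Φ x ≠ 0 → ∃ b ∈ L, e b x ≠ 1) :
    T Φ = 0 := by
  refine apply_eq_zero_of_invariant (LinearMap.id) (fun a b h => h) e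
    (fun b => { toFun := fun Φ x => e b x * Φ x
                map_add' := fun Φ Ψ => by funext x; simp only [Pi.add_apply]; ring
                map_smul' := fun c Φ => by funext x; simp only [Pi.smul_apply, smul_eq_mul, RingHom.id_apply]; ring })
    (fun b Φ x => rfl) hle he he0 T (fun b hb Φ => hT b hb Φ) Φ htriv hnon

end Summit.HodgeConjecture.HodgeConjecture.Cruxes.HLiu418.K2LiuInvariantFunctionalFiniteAveraging

end
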